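import Literature.LinearAlgebra.InvariantSubspaceLatticeDirectSum
import HarnessLib

/-!
# Brickman–Fillmore's Theorem 10: for commuting `A`, `B`, `L(A) ⊆ L(B)` iff `B` is a polynomial in `A`

[topic LinearAlgebra]

Topic `Literature/LinearAlgebra` (namespace `Literature.LinearAlgebra`), lane `lit-hodgefound` (Track 2 foundations library;
prover seat `lit-hodgefound-p34`, generation 47, row g47-#13). THEOREMS ONLY (no definition, no instance, no notation, no named
fact; net debt `0`). Sequel of `NilpotentInvariantSubspaceLattice` ∕ `InvariantSubspaceLatticeDirectSum` (the lattice
`L(A) = Module.End.invtSubmodule A`); the cyclic decomposition with divisibility chain is the tree's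
`exists_isInternal_cyclicSubspace` (`CyclicDecomposition`, Hoffman–Kunze §7.2 Thm. 3), the `A`-annihilator of a vector is
`annihilatorPoly`. Any field `k`.

## Source, VERBATIM ([BF67] L. Brickman, P. A. Fillmore, *The invariant subspace lattice of a linear transformation*, Canad.
J. Math. 19 (1967) 810–822; held text `paper:doi-10-4153-cjm-1967-075-4`, p. 821)

**Theorem 10.** «Let `A` and `B` be commuting linear transformations on `V`. Then `L(A) ⊂ L(B)` if and only if `B` is a
polynomial in `A`.» Proof: «The other implication being trivial, suppose that `L(A) ⊂ L(B)`. We can write `V = V₁ ⊕ … ⊕ V_k`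
such that the `Vᵢ` are cyclic and invariant relative to `A`, and such that the minimum polynomials `mᵢ` of `A|Vᵢ` have the
property: `m_{i+1} | mᵢ` for `i = 1, …, k − 1`. By assumption the `Vᵢ` are `B`-invariant. If `e₁` is a cyclic vector for `V₁`,
there is a polynomial `q₁` such that `Be₁ = q₁(A)e₁`. Any vector `x ∈ V₁` is of the form `x = r(A)e₁` for some polynomial `r`, and
therefore `Bx = Br(A)e₁ = r(A)Be₁ = r(A)q₁(A)e₁ = q₁(A)x`, so that `B = q₁(A)` on `V₁`. In like manner, if `e₂` is a cyclic vector
for `V₂`, then `Be₂ = q₂(A)e₂` and `B = q₂(A)` on `V₂`. Consider now the vector `f = e₁ + e₂`. The subspace `(f, Af, …)` is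
`A`-invariant, hence `B`-invariant, and so `Bf = s(A)f` for some polynomial `s`. We then have `Beᵢ = s(A)eᵢ` for `i = 1, 2`, and
therefore `s = q₁ + k₁m₁ = q₂ + k₂m₂` for suitable polynomials `k₁` and `k₂`. Since `m₂ | m₁`, we conclude that `q₁(A) = q₂(A)` on
`V₂`. Hence `B = q₁(A)` on `V₁ ⊕ V₂`. Iteration of this procedure yields `B = q₁(A)` on all of `V`, and completes the proof.»
«Remark. The theorem is false if it is not assumed that `A` and `B` commute.»

## Contents (all proved)
* «the other implication being trivial»: a polynomial in `A` leaves every `A`-invariant subspace invariant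
  (`invtSubmodule_le_invtSubmodule_aeval`);
* the two steps of the proof as lemmas: `B = q(A)` on a cyclic `A`-invariant `B`-stable subspace whose generator `B` maps by
  `q(A)` (`apply_eq_aeval_apply_of_mem_cyclicSubspace`), and the comparison through `f = e₁ + e₂`
  (`aeval_apply_eq_of_disjoint`);
* **Theorem 10** (`exists_eq_aeval_of_commute_of_forall_mem_invtSubmodule`) and its `iff` forms, for the membership
  predicate and as `L(A) ≤ L(B) ↔ B ∈ k[A]` (`invtSubmodule_le_iff_mem_adjoin`); `L(A) = L(B) ↔ k[A] = k[B]`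
  (`invtSubmodule_eq_iff_adjoin_eq`).

## References
* [BrickmanFillmore1967] L. Brickman, P. A. Fillmore, Canad. J. Math. 19 (1967) 810–822, doi:10.4153/cjm-1967-075-4 — §5
  Theorem 10 (p. 821).
* [HoffmanKunze1971LinearAlgebra] K. Hoffman, R. Kunze, *Linear Algebra*, 2nd ed. — §7.2 Thm. 3 (cyclic decomposition, through the
  tree's `exists_isInternal_cyclicSubspace`).
-/

open Module Polynomial

namespace Literature.LinearAlgebra

variable {k : Type*} [Field k] {V : Type*} [AddCommGroup V] [Module k V]

section Inclusion

variable (γ : Module.End k V)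

/-- **«The other implication being trivial»: `L(A) ⊆ L(q(A))`.** [cite: BrickmanFillmore1967, Thm. 10 (p. 821)] -/
theorem invtSubmodule_le_invtSubmodule_aeval (q : k[X]) : γ.invtSubmodule ≤ Module.End.invtSubmodule (aeval γ q) :=
  fun _ hW ↦ (Module.End.mem_invtSubmodule_iff_forall_mem_of_mem _).2 fun _ hx ↦
    aeval_apply_mem_of_mem_invtSubmodule' γ hW q hx

/-- **Step 1 of the proof: «`Bx = Br(A)e₁ = r(A)Be₁ = r(A)q₁(A)e₁ = q₁(A)x`, so that `B = q₁(A)` on `V₁`»** — if `B` commutes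
with `A` and `Be = q(A)e`, then `B = q(A)` on the cyclic subspace `Z(e; A)`. [cite: BrickmanFillmore1967, Thm. 10 proof (p. 821)] -/
theorem apply_eq_aeval_apply_of_mem_cyclicSubspace {B : Module.End k V} (hc : Commute γ B) {e : V} {q : k[X]}
    (he : B e = aeval γ q e) {x : V} (hx : x ∈ cyclicSubspace γ e) : B x = aeval γ q x := by
  obtain ⟨r, rfl⟩ := (mem_cyclicSubspace_iff γ e).1 hx
  have hB : B ∈ Subalgebra.centralizer k ({γ} : Set (Module.End k V)) := by
    rw [Subalgebra.mem_centralizer_iff]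
    intro g hg
    rw [Set.mem_singleton_iff.1 hg]
    exact hc.eq
  rw [← Module.End.mul_apply, mul_aeval_eq_aeval_mul_of_mem_centralizer hB r, Module.End.mul_apply, he,
    ← Module.End.mul_apply, ← map_mul, mul_comm, map_mul, Module.End.mul_apply]

/-- **Step 2 of the proof: «Consider now the vector `f = e₁ + e₂` … `Bf = s(A)f` … `s = q₁ + k₁m₁ = q₂ + k₂m₂` … Since
`m₂ | m₁`, we conclude that `q₁(A) = q₂(A)` on `V₂`»** — for disjoint `Z(e₁)`, `Z(e₂)` with `p_{e₂} ∣ p_{e₁}` (annihilators),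
`Beᵢ = qᵢ(A)eᵢ` and `B(e₁ + e₂) ∈ Z(e₁ + e₂)` force `q₁(A)e₂ = q₂(A)e₂`. [cite: BrickmanFillmore1967, Thm. 10 proof (p. 821)] -/
theorem aeval_apply_eq_of_disjoint {B : Module.End k V} {e₁ e₂ : V} (hd : Disjoint (cyclicSubspace γ e₁) (cyclicSubspace γ e₂))
    (hm : annihilatorPoly γ e₂ ∣ annihilatorPoly γ e₁) {q₁ q₂ : k[X]} (h₁ : B e₁ = aeval γ q₁ e₁) (h₂ : B e₂ = aeval γ q₂ e₂)
    (hf : B (e₁ + e₂) ∈ cyclicSubspace γ (e₁ + e₂)) : aeval γ q₁ e₂ = aeval γ q₂ e₂ := by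
  obtain ⟨s, hs⟩ := (mem_cyclicSubspace_iff γ _).1 hf
  have hs' : aeval γ s e₁ + aeval γ s e₂ = aeval γ q₁ e₁ + aeval γ q₂ e₂ := by
    rw [← map_add, hs, map_add, h₁, h₂]
  -- `(s - q₁)(A)e₁ = (q₂ - s)(A)e₂ ∈ Z(e₁) ∩ Z(e₂) = 0`
  have heq : aeval γ (s - q₁) e₁ = aeval γ (q₂ - s) e₂ := by
    rw [map_sub, map_sub, LinearMap.sub_apply, LinearMap.sub_apply, sub_eq_sub_iff_add_eq_add, hs', add_comm]
  have h0 : aeval γ (s - q₁) e₁ = 0 :=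
    (Submodule.disjoint_def.1 hd) _ (aeval_apply_self_mem_cyclicSubspace γ e₁ _)
      (heq ▸ aeval_apply_self_mem_cyclicSubspace γ e₂ _)
  have h0' : aeval γ (q₂ - s) e₂ = 0 := heq ▸ h0
  -- `m₁ ∣ s - q₁`, `m₂ ∣ q₂ - s`, `m₂ ∣ m₁` ⟹ `m₂ ∣ q₂ - q₁`
  have hdvd : annihilatorPoly γ e₂ ∣ q₂ - q₁ := by
    have h1 : annihilatorPoly γ e₂ ∣ s - q₁ := hm.trans ((annihilatorPoly_dvd_iff γ e₁).2 h0)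
    have h2 : annihilatorPoly γ e₂ ∣ q₂ - s := (annihilatorPoly_dvd_iff γ e₂).2 h0'
    have h3 := dvd_add h2 h1
    rwa [sub_add_sub_cancel] at h3
  have h4 := (annihilatorPoly_dvd_iff γ e₂).1 hdvd
  rw [map_sub, LinearMap.sub_apply, sub_eq_zero] at h4
  exact h4.symm

variable [FiniteDimensional k V]

/-- **Brickman–Fillmore THEOREM 10: if `A` and `B` commute and every `A`-invariant subspace is `B`-invariant, then `B` is a
polynomial in `A`.** Proof as printed: a cyclic decomposition `V = ⊕ Z(eᵢ; A)` with `p_{e_j} ∣ p_{e_i}` (`i ≤ j`); `B = qᵢ(A)` on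
`Z(eᵢ)`; comparing through `f = e₁ + eᵢ` gives `q₁(A) = qᵢ(A)` on `Z(eᵢ)`; so `B = q₁(A)`. [cite: BrickmanFillmore1967, Thm. 10 (p. 821)] -/
theorem exists_eq_aeval_of_commute_of_forall_mem_invtSubmodule {B : Module.End k V} (hc : Commute γ B)
    (hL : ∀ W ∈ γ.invtSubmodule, W ∈ B.invtSubmodule) : ∃ q : k[X], B = aeval γ q := by
  obtain ⟨r, v, -, hint, hchain, -⟩ := exists_isInternal_cyclicSubspace γ
  have hBmem : ∀ w : V, B w ∈ cyclicSubspace γ w := fun w ↦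
    (Module.End.mem_invtSubmodule_iff_forall_mem_of_mem _).1 (hL _ (cyclicSubspace_mem_invtSubmodule γ w)) w
      (self_mem_cyclicSubspace γ w)
  rcases Nat.eq_zero_or_pos r with rfl | hr
  · -- no summand: `V = 0`
    refine ⟨0, LinearMap.ext fun x ↦ ?_⟩
    have hx : x ∈ (⨆ i : Fin 0, cyclicSubspace γ (v i)) := hint.submodule_iSup_eq_top.symm ▸ Submodule.mem_top
    rw [iSup_of_empty, Submodule.mem_bot] at hx
    rw [hx, map_zero, map_zero]
  · -- `B eᵢ = qᵢ(A) eᵢ`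
    choose q hq using fun i : Fin r ↦ (mem_cyclicSubspace_iff γ (v i)).1 (hBmem (v i))
    set i₀ : Fin r := ⟨0, hr⟩
    -- `q_{i₀}(A) eᵢ = qᵢ(A) eᵢ` for every `i`
    have hqq : ∀ i : Fin r, aeval γ (q i₀) (v i) = aeval γ (q i) (v i) := by
      intro i
      by_cases hi : i = i₀
      · rw [hi]
      · exact aeval_apply_eq_of_disjoint γ (hint.submodule_iSupIndep.pairwiseDisjoint (Ne.symm hi))
          (hchain i₀ i (Fin.le_iff_val_le_val.2 (Nat.zero_le _))) (hq i₀).symm (hq i).symm (hBmem _)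
    refine ⟨q i₀, LinearMap.ext fun x ↦ ?_⟩
    have hx : x ∈ ⨆ i, cyclicSubspace γ (v i) := hint.submodule_iSup_eq_top.symm ▸ Submodule.mem_top
    exact Submodule.iSup_induction (fun i ↦ cyclicSubspace γ (v i)) (motive := fun x ↦ B x = aeval γ (q i₀) x) hx
      (fun i x hx ↦ apply_eq_aeval_apply_of_mem_cyclicSubspace γ hc ((hq i).symm.trans (hqq i).symm) hx)
      (by rw [map_zero, map_zero]) (fun x y hx hy ↦ by rw [map_add, map_add, hx, hy])

/-- **Theorem 10 as an `iff`: for commuting `A`, `B`: `L(A) ⊆ L(B) ⟺ B ∈ k[A]`.** [cite: BrickmanFillmore1967, Thm. 10 (p. 821)] -/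
theorem forall_mem_invtSubmodule_iff_exists_eq_aeval {B : Module.End k V} (hc : Commute γ B) :
    (∀ W ∈ γ.invtSubmodule, W ∈ B.invtSubmodule) ↔ ∃ q : k[X], B = aeval γ q :=
  ⟨exists_eq_aeval_of_commute_of_forall_mem_invtSubmodule γ hc, fun ⟨q, hq⟩ _ hW ↦
    hq ▸ invtSubmodule_le_invtSubmodule_aeval γ q hW⟩

/-- **Theorem 10, sublattice form: for commuting `A`, `B`, `L(A) ≤ L(B)` in the lattice of sublattices of `Sub(V)` iff
`B ∈ k[A] = Algebra.adjoin k {A}`.** [cite: BrickmanFillmore1967, Thm. 10 (p. 821)] -/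
theorem invtSubmodule_le_iff_mem_adjoin {B : Module.End k V} (hc : Commute γ B) :
    γ.invtSubmodule ≤ B.invtSubmodule ↔ B ∈ Algebra.adjoin k {γ} := by
  rw [Algebra.adjoin_singleton_eq_range_aeval, AlgHom.mem_range]
  exact (forall_mem_invtSubmodule_iff_exists_eq_aeval γ hc).trans ⟨fun ⟨q, hq⟩ ↦ ⟨q, hq.symm⟩, fun ⟨q, hq⟩ ↦ ⟨q, hq.symm⟩⟩

/-- **Corollary: commuting `A`, `B` have THE SAME invariant subspaces iff `k[A] = k[B]`** (each is a polynomial in the other).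
[cite: BrickmanFillmore1967, Thm. 10 (p. 821)] -/
theorem invtSubmodule_eq_iff_adjoin_eq {B : Module.End k V} (hc : Commute γ B) :
    γ.invtSubmodule = B.invtSubmodule ↔ Algebra.adjoin k {γ} = Algebra.adjoin k ({B} : Set (Module.End k V)) := by
  constructor
  · intro h
    have hB : B ∈ Algebra.adjoin k {γ} := (invtSubmodule_le_iff_mem_adjoin γ hc).1 h.le
    have hγ : γ ∈ Algebra.adjoin k {B} := (invtSubmodule_le_iff_mem_adjoin B hc.symm).1 h.ge
    exact le_antisymm (Algebra.adjoin_le (Set.singleton_subset_iff.2 hγ))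
      (Algebra.adjoin_le (Set.singleton_subset_iff.2 hB))
  · intro h
    exact le_antisymm ((invtSubmodule_le_iff_mem_adjoin γ hc).2 (h ▸ Algebra.self_mem_adjoin_singleton k B))
      ((invtSubmodule_le_iff_mem_adjoin B hc.symm).2 (h.symm ▸ Algebra.self_mem_adjoin_singleton k γ))

end Inclusion

end Literature.LinearAlgebra
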